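import Literature.RingTheory.FormalGroups.FormalOModuleBudCongr
import HarnessLib

/-!
# Buds of formal `𝒪`-module laws, III: the variation of the defects under a perturbation of order `≥ m`
# ([Lazard 1955] §II Lemme 2 ∕ §III; [Drinfeld 1974] §1; [Hazewinkel 1978] §5.7)

Topic `Literature/RingTheory/FormalGroups`; namespace `Literature.RingTheory.FormalGroups`.  DEFINITIONS (the five linear
«variation» expressions) + fully proved theorems; no named fact, no instance, no notation, no `sorry`.  Cell `hodgecm-mathlib`,
P6 «MOD programme», sub-line P6d (power-series layer for `stub_L4B3cO`).

THE VARIATION LEMMA (Lazard's computation behind «deux bourgeons qui coïncident jusqu'à l'ordre `m − 1` diffèrent par un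
cocycle»).  Let `(F°, ρ°)` be bud data (`F° ≡ X₀+X₁`, `ρ°_a ≡ a·X (mod deg 2)`, no constant terms) and let `Γ`, `θ_a` be
perturbations of order `≥ m ≥ 2`.  Then, MODULO DEGREE `m + 1`, each defect of `(F° + Γ, ρ° + θ)` is the defect of
`(F°, ρ°)` plus a LINEAR expression in `(Γ, θ)` evaluated at the ADDITIVE data:
* `assocVar Γ = Γ(Y₀,Y₁) + Γ(Y₀+Y₁,Y₂) − Γ(Y₁,Y₂) − Γ(Y₀,Y₁+Y₂)` (`le_order_assocDefect_add_sub`),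
* commutativity: `commDefect Γ` (exact, `commDefect_add`),
* `homVar c Γ θ = θ(X₀+X₁) + c·Γ − Γ(cX₀,cX₁) − θ(X₀) − θ(X₁)`, `c = a·1_B` (`le_order_homDefect_add_sub`),
* `addVar c_a c_b Γ θ_a θ_b θ_{a+b} = θ_{a+b} − θ_a − θ_b − Γ(c_a X, c_b X)` (`le_order_addDefect_add_sub`),
* `mulVar c_a c_b θ_a θ_b θ_{ab} = θ_{ab} − c_a·θ_b − θ_a(c_b X)` (`le_order_mulDefect_add_sub`).
The proofs are Lazard's Lemme 1 (★ `DegreeCongruence`) and its first-order refinements for series `≡ X₀+X₁`, `≡ c·X (mod deg 2)`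
(`le_order_subst_sub_subst_sub_lin`, `le_order_psubst_sub_psubst_sub_smul`).

Deliberately NOT here: the degree-`m` coefficients of the variations (sibling `FormalOModuleBudCocycle`) and their
identification with Lazard ∕ Drinfeld cocycles.
-/

noncomputable section

namespace Literature.RingTheory.FormalGroups

open MvPowerSeries (HasSubst subst X order)

universe u v

variable {B : Type v} [CommRing B]

/-! ## §1 First-order expansions -/

/-- **First-order expansion of a series `F ≡ X₀ + X₁ (mod deg 2)`**: for arguments `aᵢ ≡ bᵢ (mod deg N)` (`N ≥ 1`) without
constant term, `F(a₀,a₁) ≡ F(b₀,b₁) + (a₀ − b₀) + (a₁ − b₁) (mod deg N+1)`. [cite: Lazard1955, §I Lemme 1] -/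
theorem le_order_subst_sub_subst_sub_lin {τ : Type*} {F : MvPowerSeries (Fin 2) B}
    (hF : ((2 : ℕ) : ℕ∞) ≤ (F - X 0 - X 1).order) {N : ℕ} (hN : 1 ≤ N)
    {a b : Fin 2 → MvPowerSeries τ B} (ha : ∀ i, MvPowerSeries.constantCoeff (a i) = 0)
    (hb : ∀ i, MvPowerSeries.constantCoeff (b i) = 0) (hab : ∀ i, (N : ℕ∞) ≤ (a i - b i).order) :
    ((N + 1 : ℕ) : ℕ∞) ≤ (F.subst a - F.subst b - ((a 0 - b 0) + (a 1 - b 1))).order := by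
  set F₂ : MvPowerSeries (Fin 2) B := F - X 0 - X 1 with hF₂
  have hsplit : ∀ c : Fin 2 → MvPowerSeries τ B, (∀ i, MvPowerSeries.constantCoeff (c i) = 0) →
      F.subst c = c 0 + c 1 + F₂.subst c := by
    intro c hc
    have hcs := MvPowerSeries.hasSubst_of_constantCoeff_zero hc
    rw [hF₂, MvPowerSeries.subst_sub hcs, MvPowerSeries.subst_sub hcs, MvPowerSeries.subst_X hcs,
      MvPowerSeries.subst_X hcs]
    ring
  rw [hsplit a ha, hsplit b hb]
  have h := le_order_subst_sub_subst (by norm_num) hN hF ha hb hab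
  have e : a 0 + a 1 + F₂.subst a - (b 0 + b 1 + F₂.subst b) - (a 0 - b 0 + (a 1 - b 1)) = F₂.subst a - F₂.subst b := by
    ring
  rw [e]
  exact natCast_le_order_of_le h (by omega)

/-- **First-order expansion of a series `ψ ≡ c·X (mod deg 2)`**: for `u ≡ u′ (mod deg N)` (`N ≥ 1`) without constant term,
`ψ(u) ≡ ψ(u′) + c·(u − u′) (mod deg N+1)`. [cite: Lazard1955, §I Lemme 1] -/
theorem le_order_psubst_sub_psubst_sub_smul {τ : Type*} {ψ : PowerSeries B} {c : B}
    (hψ : ((2 : ℕ) : ℕ∞) ≤ MvPowerSeries.order (ψ - c • PowerSeries.X)) {N : ℕ} (hN : 1 ≤ N)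
    {u u' : MvPowerSeries τ B} (hu : MvPowerSeries.constantCoeff u = 0) (hu' : MvPowerSeries.constantCoeff u' = 0)
    (huu' : (N : ℕ∞) ≤ (u - u').order) :
    ((N + 1 : ℕ) : ℕ∞) ≤ (PowerSeries.subst u ψ - PowerSeries.subst u' ψ - c • (u - u')).order := by
  set ψ₂ : PowerSeries B := ψ - c • PowerSeries.X with hψ₂
  have hψ₂c : ∀ i < 2, PowerSeries.coeff i ψ₂ = 0 := fun i hi =>
    (natCast_le_order_iff.1 hψ) (Finsupp.single () i) (by simpa using hi)
  have hsplit : ∀ w : MvPowerSeries τ B, MvPowerSeries.constantCoeff w = 0 →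
      PowerSeries.subst w ψ = c • w + PowerSeries.subst w ψ₂ := by
    intro w hw
    have hws := PowerSeries.HasSubst.of_constantCoeff_zero hw
    rw [hψ₂, PowerSeries.subst_sub hws, PowerSeries.subst_smul hws, PowerSeries.subst_X hws]
    ring
  rw [hsplit u hu, hsplit u' hu']
  have h := le_order_psubst_sub_psubst (by norm_num) hN hψ₂c hu hu' huu'
  have e : c • u + PowerSeries.subst u ψ₂ - (c • u' + PowerSeries.subst u' ψ₂) - c • (u - u') =
      PowerSeries.subst u ψ₂ - PowerSeries.subst u' ψ₂ := by
    rw [smul_sub]; ring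
  rw [e]
  exact natCast_le_order_of_le h (by omega)

/-! ## §2 The linear variations -/

/-- **Variation of associativity**: `Γ(Y₀,Y₁) + Γ(Y₀+Y₁,Y₂) − Γ(Y₁,Y₂) − Γ(Y₀,Y₁+Y₂)` (the additive-law coboundary of `Γ`).
[cite: Lazard1955, §II Lemme 2] -/
def assocVar (Γ : MvPowerSeries (Fin 2) B) : MvPowerSeries (Fin 3) B :=
  Γ.subst ![X 0, X 1] + Γ.subst ![X 0 + X 1, X 2] - Γ.subst ![X 1, X 2] - Γ.subst ![X 0, X 1 + X 2]

/-- **Variation of the homomorphism defect**: `θ(X₀+X₁) + c·Γ − Γ(cX₀,cX₁) − θ(X₀) − θ(X₁)`. [cite: Drinfeld1974, §1 Prop. 1.4 (proof)] -/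
def homVar (c : B) (Γ : MvPowerSeries (Fin 2) B) (θ : PowerSeries B) : MvPowerSeries (Fin 2) B :=
  PowerSeries.subst (X 0 + X 1 : MvPowerSeries (Fin 2) B) θ + c • Γ - Γ.subst ![c • X 0, c • X 1] -
    PowerSeries.subst (X 0 : MvPowerSeries (Fin 2) B) θ - PowerSeries.subst (X 1 : MvPowerSeries (Fin 2) B) θ

/-- **Variation of the additivity defect**: `θ_{a+b} − θ_a − θ_b − Γ(c_a X, c_b X)`. [cite: Drinfeld1974, §1 Prop. 1.4 (proof)] -/
def addVar (ca cb : B) (Γ : MvPowerSeries (Fin 2) B) (θa θb θab : PowerSeries B) : PowerSeries B :=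
  θab - θa - θb - Γ.subst ![ca • (PowerSeries.X : PowerSeries B), cb • PowerSeries.X]

/-- **Variation of the multiplicativity defect**: `θ_{ab} − c_a·θ_b − θ_a(c_b X)`. [cite: Drinfeld1974, §1 Prop. 1.4 (proof)] -/
def mulVar (ca cb : B) (θa θb θab : PowerSeries B) : PowerSeries B :=
  θab - ca • θb - PowerSeries.subst (cb • (PowerSeries.X : PowerSeries B)) θa

/-! ## §3 The variation lemma -/

section Variation

variable {m : ℕ} {F Γ : MvPowerSeries (Fin 2) B}

/-- `F + Γ ≡ X₀ + X₁ (mod deg 2)` when `F` is and `Γ` has order `≥ m ≥ 2`. [folklore] -/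
private theorem two_le_order_add (hF : ((2 : ℕ) : ℕ∞) ≤ (F - X 0 - X 1).order) (hm : 2 ≤ m) (hΓ : (m : ℕ∞) ≤ Γ.order) :
    ((2 : ℕ) : ℕ∞) ≤ (F + Γ - X 0 - X 1).order := by
  have e : F + Γ - X 0 - X 1 = (F - X 0 - X 1) + Γ := by ring
  rw [e]; exact natCast_le_order_add hF (natCast_le_order_of_le hΓ hm)

/-- For `G ≡ X₀ + X₁ (mod deg 2)` and arguments `u, v` without constant term: `G(u,v) ≡ u + v (mod deg 2)`. [folklore] -/
private theorem two_le_order_subst_pair_sub {τ : Type*} {G : MvPowerSeries (Fin 2) B}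
    (hG : ((2 : ℕ) : ℕ∞) ≤ (G - X 0 - X 1).order) {u v : MvPowerSeries τ B}
    (hu : MvPowerSeries.constantCoeff u = 0) (hv : MvPowerSeries.constantCoeff v = 0) :
    ((2 : ℕ) : ℕ∞) ≤ (G.subst ![u, v] - (u + v)).order := by
  have ha : ∀ i, MvPowerSeries.constantCoeff ((![u, v] : Fin 2 → MvPowerSeries τ B) i) = 0 := fun i => by
    fin_cases i <;> assumption
  have hs := MvPowerSeries.hasSubst_of_constantCoeff_zero ha
  have e : G.subst ![u, v] - (u + v) = (G - X 0 - X 1).subst ![u, v] := by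
    rw [MvPowerSeries.subst_sub hs, MvPowerSeries.subst_sub hs, MvPowerSeries.subst_X hs, MvPowerSeries.subst_X hs]
    simp only [Matrix.cons_val_zero, Matrix.cons_val_one, Matrix.cons_val_fin_one]
    ring
  rw [e]; exact le_order_subst_of_le hG ha

/-- The constant coefficient of `G(u,v)` vanishes (arguments without constant term). [folklore] -/
private theorem constantCoeff_subst_pair' {τ : Type*} {G : MvPowerSeries (Fin 2) B} (hG : MvPowerSeries.constantCoeff G = 0)
    {u v : MvPowerSeries τ B} (hu : MvPowerSeries.constantCoeff u = 0) (hv : MvPowerSeries.constantCoeff v = 0) :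
    MvPowerSeries.constantCoeff (G.subst ![u, v]) = 0 :=
  MvPowerSeries.constantCoeff_subst_eq_zero (MvPowerSeries.hasSubst_of_constantCoeff_zero fun i => by fin_cases i <;> assumption)
    (fun i => by fin_cases i <;> assumption) hG

/-- Lazard's Lemme 1 for a perturbation `Γ` of order `≥ m` (`m ≥ 1`) at pairs of arguments congruent `mod deg 2`:
`Γ(u,v) ≡ Γ(u′,v′) (mod deg m+1)`. [cite: Lazard1955, §I Lemme 1] -/
private theorem le_order_subst_pair_sub_of_two {τ : Type*} (hm : 1 ≤ m) (hΓ : (m : ℕ∞) ≤ Γ.order)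
    {u u' v v' : MvPowerSeries τ B} (hu : MvPowerSeries.constantCoeff u = 0) (hu' : MvPowerSeries.constantCoeff u' = 0)
    (hv : MvPowerSeries.constantCoeff v = 0) (hv' : MvPowerSeries.constantCoeff v' = 0)
    (huu' : ((2 : ℕ) : ℕ∞) ≤ (u - u').order) (hvv' : ((2 : ℕ) : ℕ∞) ≤ (v - v').order) :
    ((m + 1 : ℕ) : ℕ∞) ≤ (Γ.subst ![u, v] - Γ.subst ![u', v']).order := by
  have h := le_order_subst_sub_subst hm (by norm_num : 1 ≤ 2) hΓ (a := ![u, v]) (b := ![u', v'])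
    (fun i => by fin_cases i <;> assumption) (fun i => by fin_cases i <;> assumption)
    (fun i => by fin_cases i <;> assumption)
  exact natCast_le_order_of_le h (by omega)

/-- **Variation of the associativity defect**: for `F ≡ X₀+X₁ (mod deg 2)` without constant term and `Γ` of order
`≥ m ≥ 2`, `assocDefect (F + Γ) ≡ assocDefect F + assocVar Γ (mod deg m+1)`. [cite: Lazard1955, §II Lemme 2] -/
theorem le_order_assocDefect_add_sub (hF0 : MvPowerSeries.constantCoeff F = 0)
    (hF : ((2 : ℕ) : ℕ∞) ≤ (F - X 0 - X 1).order) (hm : 2 ≤ m) (hΓ : (m : ℕ∞) ≤ Γ.order) :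
    ((m + 1 : ℕ) : ℕ∞) ≤ (assocDefect (F + Γ) - assocDefect F - assocVar Γ).order := by
  have hX : ∀ i : Fin 3, MvPowerSeries.constantCoeff (X i : MvPowerSeries (Fin 3) B) = 0 := fun i =>
    MvPowerSeries.constantCoeff_X i
  have hΓ0 : MvPowerSeries.constantCoeff Γ = 0 := by
    have := (natCast_le_order_iff.1 hΓ) 0 (by simp; omega)
    simpa using this
  have hFΓ0 : MvPowerSeries.constantCoeff (F + Γ) = 0 := by rw [map_add, hF0, hΓ0, add_zero]
  -- the arguments
  have h01 : HasSubst (![X 0, X 1] : Fin 2 → MvPowerSeries (Fin 3) B) := HasSubst.X_X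
  have h12 : HasSubst (![X 1, X 2] : Fin 2 → MvPowerSeries (Fin 3) B) := HasSubst.X_X
  set u := F.subst (![X 0, X 1] : Fin 2 → MvPowerSeries (Fin 3) B) with hu
  set v := F.subst (![X 1, X 2] : Fin 2 → MvPowerSeries (Fin 3) B) with hv
  set gu := Γ.subst (![X 0, X 1] : Fin 2 → MvPowerSeries (Fin 3) B) with hgu
  set gv := Γ.subst (![X 1, X 2] : Fin 2 → MvPowerSeries (Fin 3) B) with hgv
  have hu2 : (F + Γ).subst (![X 0, X 1] : Fin 2 → MvPowerSeries (Fin 3) B) = u + gu := MvPowerSeries.subst_add h01 _ _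
  have hv2 : (F + Γ).subst (![X 1, X 2] : Fin 2 → MvPowerSeries (Fin 3) B) = v + gv := MvPowerSeries.subst_add h12 _ _
  have hu0 : MvPowerSeries.constantCoeff u = 0 := constantCoeff_subst_pair' hF0 (hX 0) (hX 1)
  have hv0 : MvPowerSeries.constantCoeff v = 0 := constantCoeff_subst_pair' hF0 (hX 1) (hX 2)
  have hgu0 : MvPowerSeries.constantCoeff gu = 0 := constantCoeff_subst_pair' hΓ0 (hX 0) (hX 1)
  have hgv0 : MvPowerSeries.constantCoeff gv = 0 := constantCoeff_subst_pair' hΓ0 (hX 1) (hX 2)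
  have hugu0 : MvPowerSeries.constantCoeff (u + gu) = 0 := by rw [map_add, hu0, hgu0, add_zero]
  have hvgv0 : MvPowerSeries.constantCoeff (v + gv) = 0 := by rw [map_add, hv0, hgv0, add_zero]
  have hguord : (m : ℕ∞) ≤ gu.order := le_order_subst_of_le hΓ fun i => by fin_cases i <;> exact hX _
  have hgvord : (m : ℕ∞) ≤ gv.order := le_order_subst_of_le hΓ fun i => by fin_cases i <;> exact hX _
  -- T1: first-order expansion of `F` in the outer left slot
  have T1 : ((m + 1 : ℕ) : ℕ∞) ≤ (F.subst ![u + gu, X 2] - F.subst ![u, X 2] - gu).order := by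
    have h := le_order_subst_sub_subst_sub_lin hF (by omega : 1 ≤ m) (a := ![u + gu, X 2]) (b := ![u, X 2])
      (fun i => by fin_cases i <;> simp [hugu0]) (fun i => by fin_cases i <;> simp [hu0])
      (fun i => by fin_cases i <;> simp [hguord])
    simpa using h
  -- T2: Lazard's Lemme 1 for `Γ` in the outer left slot
  have T2 : ((m + 1 : ℕ) : ℕ∞) ≤ (Γ.subst ![u + gu, X 2] - Γ.subst ![X 0 + X 1, X 2]).order :=
    le_order_subst_pair_sub_of_two (by omega) hΓ hugu0 (by simp) (hX 2) (hX 2)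
      (by rw [hu2.symm]; exact two_le_order_subst_pair_sub (two_le_order_add hF hm hΓ) (hX 0) (hX 1)) (by simp)
  -- T3, T4: the same on the right
  have T3 : ((m + 1 : ℕ) : ℕ∞) ≤ (F.subst ![X 0, v + gv] - F.subst ![X 0, v] - gv).order := by
    have h := le_order_subst_sub_subst_sub_lin hF (by omega : 1 ≤ m) (a := ![X 0, v + gv]) (b := ![X 0, v])
      (fun i => by fin_cases i <;> simp [hvgv0]) (fun i => by fin_cases i <;> simp [hv0])
      (fun i => by fin_cases i <;> simp [hgvord])
    simpa using h
  have T4 : ((m + 1 : ℕ) : ℕ∞) ≤ (Γ.subst ![X 0, v + gv] - Γ.subst ![X 0, X 1 + X 2]).order :=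
    le_order_subst_pair_sub_of_two (by omega) hΓ (hX 0) (hX 0) hvgv0 (by simp) (by simp)
      (by rw [hv2.symm]; exact two_le_order_subst_pair_sub (two_le_order_add hF hm hΓ) (hX 1) (hX 2))
  have e : assocDefect (F + Γ) - assocDefect F - assocVar Γ =
      (F.subst ![u + gu, X 2] - F.subst ![u, X 2] - gu) + (Γ.subst ![u + gu, X 2] - Γ.subst ![X 0 + X 1, X 2])
      - (F.subst ![X 0, v + gv] - F.subst ![X 0, v] - gv) - (Γ.subst ![X 0, v + gv] - Γ.subst ![X 0, X 1 + X 2]) := by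
    have hl : HasSubst (![u + gu, X 2] : Fin 2 → MvPowerSeries (Fin 3) B) :=
      MvPowerSeries.hasSubst_of_constantCoeff_zero fun i => by fin_cases i <;> simp [hugu0]
    have hr : HasSubst (![X 0, v + gv] : Fin 2 → MvPowerSeries (Fin 3) B) :=
      MvPowerSeries.hasSubst_of_constantCoeff_zero fun i => by fin_cases i <;> simp [hvgv0]
    rw [assocDefect, assocDefect, assocVar, hu2, hv2, MvPowerSeries.subst_add hl, MvPowerSeries.subst_add hr]
    ring
  rw [e]
  exact natCast_le_order_sub (natCast_le_order_sub (natCast_le_order_add T1 T2) T3) T4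

/-- **Variation of the commutativity defect** (exact): `commDefect (F + Γ) = commDefect F + commDefect Γ`.
[cite: Lazard1955, §II Lemme 2] -/
theorem commDefect_add (F Γ : MvPowerSeries (Fin 2) B) : commDefect (F + Γ) = commDefect F + commDefect Γ := by
  rw [commDefect, commDefect, commDefect, MvPowerSeries.subst_add HasSubst.X_X]
  ring

/-- A univariate series of order `≥ m ≥ 1` has no constant term. [folklore] -/
private theorem constantCoeff_eq_zero_of_le_order {θ : PowerSeries B} (hm : 1 ≤ m) (hθ : (m : ℕ∞) ≤ MvPowerSeries.order θ) :
    PowerSeries.constantCoeff θ = 0 := by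
  have := (natCast_le_order_iff.1 hθ) 0 (by simp; omega)
  rw [MvPowerSeries.coeff_zero_eq_constantCoeff_apply] at this
  exact this

/-- `c·X` has no constant term (in `MvPowerSeries Unit` currency). [folklore] -/
private theorem constantCoeff_smul_X' (c : B) : MvPowerSeries.constantCoeff (c • (PowerSeries.X : PowerSeries B)) = 0 := by
  change PowerSeries.constantCoeff (c • PowerSeries.X) = 0
  simp

/-- Coefficient form of `↑m ≤ order θ` for a univariate series. [folklore] -/
private theorem coeff_eq_zero_of_le_order {θ : PowerSeries B} (hθ : (m : ℕ∞) ≤ MvPowerSeries.order θ) :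
    ∀ i < m, PowerSeries.coeff i θ = 0 := fun i hi =>
  (natCast_le_order_iff.1 hθ) (Finsupp.single () i) (by simpa using hi)

/-- For `ψ ≡ c·X (mod deg 2)` and `w` without constant term, `ψ(w) ≡ c·w (mod deg 2)`. [folklore] -/
private theorem two_le_order_psubst_sub_smul {τ : Type*} {ψ : PowerSeries B} {c : B}
    (hψ : ((2 : ℕ) : ℕ∞) ≤ MvPowerSeries.order (ψ - c • PowerSeries.X)) {w : MvPowerSeries τ B}
    (hw : MvPowerSeries.constantCoeff w = 0) : ((2 : ℕ) : ℕ∞) ≤ (PowerSeries.subst w ψ - c • w).order := by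
  have hws := PowerSeries.HasSubst.of_constantCoeff_zero hw
  have e : PowerSeries.subst w ψ - c • w = PowerSeries.subst w (ψ - c • PowerSeries.X) := by
    rw [PowerSeries.subst_sub hws, PowerSeries.subst_smul hws, PowerSeries.subst_X hws]
  rw [e]; exact le_order_psubst_of_le hψ hw

/-- **Variation of the homomorphism defect**: for `F ≡ X₀+X₁`, `φ ≡ c·X (mod deg 2)` without constant terms and `Γ`, `θ`
of order `≥ m ≥ 2`, `homDefect (F+Γ) (φ+θ) ≡ homDefect F φ + homVar c Γ θ (mod deg m+1)`.
[cite: Lazard1955, §II Lemme 2] [cite: Drinfeld1974, §1 Prop. 1.4 (proof)] -/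
theorem le_order_homDefect_add_sub {φ θ : PowerSeries B} {c : B} (hF0 : MvPowerSeries.constantCoeff F = 0)
    (hF : ((2 : ℕ) : ℕ∞) ≤ (F - X 0 - X 1).order) (hφ0 : PowerSeries.constantCoeff φ = 0)
    (hφ : ((2 : ℕ) : ℕ∞) ≤ MvPowerSeries.order (φ - c • PowerSeries.X)) (hm : 2 ≤ m) (hΓ : (m : ℕ∞) ≤ Γ.order)
    (hθ : (m : ℕ∞) ≤ MvPowerSeries.order θ) :
    ((m + 1 : ℕ) : ℕ∞) ≤ (homDefect (F + Γ) (φ + θ) - homDefect F φ - homVar c Γ θ).order := by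
  have hX : ∀ i : Fin 2, MvPowerSeries.constantCoeff (X i : MvPowerSeries (Fin 2) B) = 0 := fun i =>
    MvPowerSeries.constantCoeff_X i
  have hΓ0 : MvPowerSeries.constantCoeff Γ = 0 := by
    have := (natCast_le_order_iff.1 hΓ) 0 (by simp; omega)
    simpa using this
  have hθ0 : PowerSeries.constantCoeff θ = 0 := constantCoeff_eq_zero_of_le_order (by omega) hθ
  have hFΓ0 : MvPowerSeries.constantCoeff (F + Γ) = 0 := by rw [map_add, hF0, hΓ0, add_zero]
  have hφθ0 : PowerSeries.constantCoeff (φ + θ) = 0 := by rw [map_add, hφ0, hθ0, add_zero]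
  -- the arguments `wᵢ = φ(Xᵢ)`, `tᵢ = θ(Xᵢ)`
  set w0 := PowerSeries.subst (X 0 : MvPowerSeries (Fin 2) B) φ with hw0
  set w1 := PowerSeries.subst (X 1 : MvPowerSeries (Fin 2) B) φ with hw1
  set t0 := PowerSeries.subst (X 0 : MvPowerSeries (Fin 2) B) θ with ht0
  set t1 := PowerSeries.subst (X 1 : MvPowerSeries (Fin 2) B) θ with ht1
  have hwt : ∀ i : Fin 2, PowerSeries.subst (X i : MvPowerSeries (Fin 2) B) (φ + θ) =
      PowerSeries.subst (X i) φ + PowerSeries.subst (X i) θ := fun i => PowerSeries.subst_add (PowerSeries.HasSubst.X i) _ _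
  have hw00 : MvPowerSeries.constantCoeff w0 = 0 := PowerSeries.constantCoeff_subst_eq_zero (hX 0) φ hφ0
  have hw10 : MvPowerSeries.constantCoeff w1 = 0 := PowerSeries.constantCoeff_subst_eq_zero (hX 1) φ hφ0
  have ht00 : MvPowerSeries.constantCoeff t0 = 0 := PowerSeries.constantCoeff_subst_eq_zero (hX 0) θ hθ0
  have ht10 : MvPowerSeries.constantCoeff t1 = 0 := PowerSeries.constantCoeff_subst_eq_zero (hX 1) θ hθ0
  have hwt00 : MvPowerSeries.constantCoeff (w0 + t0) = 0 := by rw [map_add, hw00, ht00, add_zero]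
  have hwt10 : MvPowerSeries.constantCoeff (w1 + t1) = 0 := by rw [map_add, hw10, ht10, add_zero]
  have ht0ord : (m : ℕ∞) ≤ t0.order := le_order_psubst_of_le hθ (hX 0)
  have ht1ord : (m : ℕ∞) ≤ t1.order := le_order_psubst_of_le hθ (hX 1)
  -- S1: first-order expansion of `φ` at `F + Γ` vs `F`
  have S1 : ((m + 1 : ℕ) : ℕ∞) ≤ (PowerSeries.subst (F + Γ) φ - PowerSeries.subst F φ - c • Γ).order := by
    have h := le_order_psubst_sub_psubst_sub_smul hφ (by omega : 1 ≤ m) hFΓ0 hF0 (by simpa using hΓ)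
    simpa using h
  -- S2: Lazard's Lemme 1 for `θ` at `F + Γ` vs `X₀ + X₁`
  have S2 : ((m + 1 : ℕ) : ℕ∞) ≤ (PowerSeries.subst (F + Γ) θ - PowerSeries.subst (X 0 + X 1 : MvPowerSeries (Fin 2) B) θ).order := by
    have h01 : MvPowerSeries.constantCoeff (X 0 + X 1 : MvPowerSeries (Fin 2) B) = 0 := by simp
    have h := le_order_psubst_sub_psubst (by omega : 1 ≤ m) (by norm_num : 1 ≤ 2) (coeff_eq_zero_of_le_order hθ)
      hFΓ0 h01 (by have := two_le_order_add hF hm hΓ; rwa [sub_sub] at this)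
    exact natCast_le_order_of_le h (by omega)
  -- S3: first-order expansion of `F` at `(w₀+t₀, w₁+t₁)` vs `(w₀, w₁)`
  have S3 : ((m + 1 : ℕ) : ℕ∞) ≤ (F.subst ![w0 + t0, w1 + t1] - F.subst ![w0, w1] - (t0 + t1)).order := by
    have h := le_order_subst_sub_subst_sub_lin hF (by omega : 1 ≤ m) (a := ![w0 + t0, w1 + t1]) (b := ![w0, w1])
      (fun i => by fin_cases i <;> simp [hwt00, hwt10]) (fun i => by fin_cases i <;> simp [hw00, hw10])
      (fun i => by fin_cases i <;> simp [ht0ord, ht1ord])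
    simpa using h
  -- S4: Lazard's Lemme 1 for `Γ` at `(w₀+t₀, w₁+t₁)` vs `(cX₀, cX₁)`
  have hlin : ∀ i : Fin 2, ((2 : ℕ) : ℕ∞) ≤ (PowerSeries.subst (X i : MvPowerSeries (Fin 2) B) φ +
      PowerSeries.subst (X i) θ - c • X i).order := fun i => by
    rw [← hwt]
    refine two_le_order_psubst_sub_smul ?_ (hX i)
    have e : φ + θ - c • PowerSeries.X = (φ - c • PowerSeries.X) + θ := by ring
    rw [e]; exact natCast_le_order_add hφ (natCast_le_order_of_le hθ hm)
  have S4 : ((m + 1 : ℕ) : ℕ∞) ≤ (Γ.subst ![w0 + t0, w1 + t1] - Γ.subst ![c • X 0, c • X 1]).order :=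
    le_order_subst_pair_sub_of_two (by omega) hΓ hwt00 (by simp) hwt10 (by simp) (hlin 0) (hlin 1)
  have e : homDefect (F + Γ) (φ + θ) - homDefect F φ - homVar c Γ θ =
      (PowerSeries.subst (F + Γ) φ - PowerSeries.subst F φ - c • Γ)
      + (PowerSeries.subst (F + Γ) θ - PowerSeries.subst (X 0 + X 1 : MvPowerSeries (Fin 2) B) θ)
      - (F.subst ![w0 + t0, w1 + t1] - F.subst ![w0, w1] - (t0 + t1))
      - (Γ.subst ![w0 + t0, w1 + t1] - Γ.subst ![c • X 0, c • X 1]) := by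
    have hwt' : HasSubst (![w0 + t0, w1 + t1] : Fin 2 → MvPowerSeries (Fin 2) B) :=
      MvPowerSeries.hasSubst_of_constantCoeff_zero fun i => by fin_cases i <;> simp [hwt00, hwt10]
    rw [homDefect, homDefect, homVar, hwt 0, hwt 1, PowerSeries.subst_add (PowerSeries.HasSubst.of_constantCoeff_zero hFΓ0),
      MvPowerSeries.subst_add hwt']
    ring
  rw [e]
  exact natCast_le_order_sub (natCast_le_order_sub (natCast_le_order_add S1 S2) S3) S4

/-- **Variation of the additivity defect**: for `F ≡ X₀+X₁`, `φ_a ≡ c_a·X`, `φ_b ≡ c_b·X (mod deg 2)` without constant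
terms and `Γ`, `θ_a`, `θ_b` of order `≥ m ≥ 2`,
`addDefect (F+Γ) (φ_a+θ_a) (φ_b+θ_b) (φ_{ab}+θ_{ab}) ≡ addDefect F φ_a φ_b φ_{ab} + addVar c_a c_b Γ θ_a θ_b θ_{ab} (mod deg m+1)`.
[cite: Lazard1955, §II Lemme 2] [cite: Drinfeld1974, §1 Prop. 1.4 (proof)] -/
theorem le_order_addDefect_add_sub {φa φb φab θa θb θab : PowerSeries B} {ca cb : B}
    (hF : ((2 : ℕ) : ℕ∞) ≤ (F - X 0 - X 1).order)
    (hφa0 : PowerSeries.constantCoeff φa = 0) (hφb0 : PowerSeries.constantCoeff φb = 0)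
    (hφa : ((2 : ℕ) : ℕ∞) ≤ MvPowerSeries.order (φa - ca • PowerSeries.X))
    (hφb : ((2 : ℕ) : ℕ∞) ≤ MvPowerSeries.order (φb - cb • PowerSeries.X)) (hm : 2 ≤ m) (hΓ : (m : ℕ∞) ≤ Γ.order)
    (hθa : (m : ℕ∞) ≤ MvPowerSeries.order θa) (hθb : (m : ℕ∞) ≤ MvPowerSeries.order θb) :
    ((m + 1 : ℕ) : ℕ∞) ≤ MvPowerSeries.order (addDefect (F + Γ) (φa + θa) (φb + θb) (φab + θab)
      - addDefect F φa φb φab - addVar ca cb Γ θa θb θab) := by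
  have hθa0 : PowerSeries.constantCoeff θa = 0 := constantCoeff_eq_zero_of_le_order (by omega) hθa
  have hθb0 : PowerSeries.constantCoeff θb = 0 := constantCoeff_eq_zero_of_le_order (by omega) hθb
  have ha0 : MvPowerSeries.constantCoeff ((φa + θa : PowerSeries B) : MvPowerSeries Unit B) = 0 := by
    change PowerSeries.constantCoeff (φa + θa) = 0; rw [map_add, hφa0, hθa0, add_zero]
  have hb0 : MvPowerSeries.constantCoeff ((φb + θb : PowerSeries B) : MvPowerSeries Unit B) = 0 := by
    change PowerSeries.constantCoeff (φb + θb) = 0; rw [map_add, hφb0, hθb0, add_zero]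
  -- S1: first-order expansion of `F`
  have S1 : ((m + 1 : ℕ) : ℕ∞) ≤ MvPowerSeries.order (F.subst ![(φa + θa : PowerSeries B), φb + θb] -
      F.subst ![(φa : MvPowerSeries Unit B), φb] - (θa + θb)) := by
    have h := le_order_subst_sub_subst_sub_lin hF (by omega : 1 ≤ m)
      (a := ![((φa + θa : PowerSeries B) : MvPowerSeries Unit B), φb + θb]) (b := ![(φa : MvPowerSeries Unit B), φb])
      (fun i => by fin_cases i <;> assumption) (fun i => by fin_cases i <;> assumption)
      (fun i => by fin_cases i <;> simp [hθa, hθb])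
    simpa using h
  -- S2: Lazard's Lemme 1 for `Γ`
  have hlin : ∀ (ψ θ : PowerSeries B) (c : B), ((2 : ℕ) : ℕ∞) ≤ MvPowerSeries.order (ψ - c • PowerSeries.X) →
      (m : ℕ∞) ≤ MvPowerSeries.order θ →
      ((2 : ℕ) : ℕ∞) ≤ MvPowerSeries.order ((ψ + θ : PowerSeries B) - c • PowerSeries.X) := fun ψ θ c hψ hθ => by
    rw [add_sub_right_comm ψ θ (c • PowerSeries.X)]
    exact natCast_le_order_add hψ (natCast_le_order_of_le hθ hm)
  have S2 : ((m + 1 : ℕ) : ℕ∞) ≤ MvPowerSeries.order (Γ.subst ![((φa + θa : PowerSeries B) : MvPowerSeries Unit B), φb + θb]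
      - Γ.subst ![ca • (PowerSeries.X : PowerSeries B), cb • PowerSeries.X]) :=
    le_order_subst_pair_sub_of_two (by omega) hΓ ha0 (constantCoeff_smul_X' ca) hb0 (constantCoeff_smul_X' cb)
      (hlin _ _ _ hφa hθa) (hlin _ _ _ hφb hθb)
  have e : addDefect (F + Γ) (φa + θa) (φb + θb) (φab + θab) - addDefect F φa φb φab - addVar ca cb Γ θa θb θab =
      -(F.subst ![(φa + θa : PowerSeries B), φb + θb] - F.subst ![(φa : MvPowerSeries Unit B), φb] - (θa + θb))
      - (Γ.subst ![((φa + θa : PowerSeries B) : MvPowerSeries Unit B), φb + θb]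
          - Γ.subst ![ca • (PowerSeries.X : PowerSeries B), cb • PowerSeries.X]) := by
    have hs : HasSubst (![((φa + θa : PowerSeries B) : MvPowerSeries Unit B), φb + θb] : Fin 2 → MvPowerSeries Unit B) :=
      MvPowerSeries.hasSubst_of_constantCoeff_zero fun i => by fin_cases i <;> assumption
    rw [addDefect, addDefect, addVar, MvPowerSeries.subst_add hs]
    ring
  rw [e, ← neg_add', MvPowerSeries.order_neg]
  exact natCast_le_order_add S1 S2

/-- **Variation of the multiplicativity defect**: for `φ_a ≡ c_a·X`, `φ_b ≡ c_b·X (mod deg 2)` without constant terms and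
`θ_a`, `θ_b` of order `≥ m ≥ 2`,
`mulDefect (φ_a+θ_a) (φ_b+θ_b) (φ_{ab}+θ_{ab}) ≡ mulDefect φ_a φ_b φ_{ab} + mulVar c_a c_b θ_a θ_b θ_{ab} (mod deg m+1)`.
[cite: Lazard1955, §II Lemme 2] [cite: Drinfeld1974, §1 Prop. 1.4 (proof)] -/
theorem le_order_mulDefect_add_sub {φa φb φab θa θb θab : PowerSeries B} {ca cb : B}
    (hφb0 : PowerSeries.constantCoeff φb = 0) (hφa : ((2 : ℕ) : ℕ∞) ≤ MvPowerSeries.order (φa - ca • PowerSeries.X))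
    (hφb : ((2 : ℕ) : ℕ∞) ≤ MvPowerSeries.order (φb - cb • PowerSeries.X)) (hm : 2 ≤ m)
    (hθa : (m : ℕ∞) ≤ MvPowerSeries.order θa) (hθb : (m : ℕ∞) ≤ MvPowerSeries.order θb) :
    ((m + 1 : ℕ) : ℕ∞) ≤ MvPowerSeries.order (mulDefect (φa + θa) (φb + θb) (φab + θab) - mulDefect φa φb φab
      - mulVar ca cb θa θb θab) := by
  have hθb0 : PowerSeries.constantCoeff θb = 0 := constantCoeff_eq_zero_of_le_order (by omega) hθb
  have hb0 : MvPowerSeries.constantCoeff ((φb + θb : PowerSeries B) : MvPowerSeries Unit B) = 0 := by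
    change PowerSeries.constantCoeff (φb + θb) = 0; rw [map_add, hφb0, hθb0, add_zero]
  -- S1: first-order expansion of `φ_a`
  have hφb0' : MvPowerSeries.constantCoeff (φb : MvPowerSeries Unit B) = 0 := hφb0
  have hdiff : (m : ℕ∞) ≤ MvPowerSeries.order (((φb + θb : PowerSeries B) : MvPowerSeries Unit B) - (φb : MvPowerSeries Unit B)) := by
    rw [add_sub_cancel_left]; exact hθb
  have S1 : ((m + 1 : ℕ) : ℕ∞) ≤ MvPowerSeries.order (PowerSeries.subst (φb + θb) φa - PowerSeries.subst φb φa - ca • θb) := by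
    have h := le_order_psubst_sub_psubst_sub_smul hφa (by omega : 1 ≤ m) hb0 hφb0' hdiff
    rwa [add_sub_cancel_left] at h
  -- S2: Lazard's Lemme 1 for `θ_a`
  have hlin : ((2 : ℕ) : ℕ∞) ≤ MvPowerSeries.order ((φb + θb : PowerSeries B) - cb • PowerSeries.X) := by
    rw [add_sub_right_comm φb θb (cb • PowerSeries.X)]
    exact natCast_le_order_add hφb (natCast_le_order_of_le hθb hm)
  have S2 : ((m + 1 : ℕ) : ℕ∞) ≤ MvPowerSeries.order (PowerSeries.subst (φb + θb) θa -
      PowerSeries.subst (cb • (PowerSeries.X : PowerSeries B)) θa) := by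
    have h := le_order_psubst_sub_psubst (by omega : 1 ≤ m) (by norm_num : 1 ≤ 2) (coeff_eq_zero_of_le_order hθa)
      hb0 (constantCoeff_smul_X' cb) hlin
    exact natCast_le_order_of_le h (by omega)
  have e : mulDefect (φa + θa) (φb + θb) (φab + θab) - mulDefect φa φb φab - mulVar ca cb θa θb θab =
      -(PowerSeries.subst (φb + θb) φa - PowerSeries.subst φb φa - ca • θb)
      - (PowerSeries.subst (φb + θb) θa - PowerSeries.subst (cb • (PowerSeries.X : PowerSeries B)) θa) := by
    rw [mulDefect, mulDefect, mulVar, PowerSeries.subst_add (PowerSeries.HasSubst.of_constantCoeff_zero hb0)]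
    ring
  rw [e, ← neg_add', MvPowerSeries.order_neg]
  exact natCast_le_order_add S1 S2

end Variation

end Literature.RingTheory.FormalGroups
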